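import Summits.QuantumFields.YangMills.Theorems.FluctuationComparisonRegPrIntLS2BetaRelativeLadderHolonomy
import HarnessLib

/-!
# S2β · Q11a′ — THE RUNG-TO-RUNG STEP OF THE RELATIVE LADDER IN RAIL-PAIR-DIFFERENCE FORM:
# `dist1 (U_far⁻¹·W_far) ≤ dist1 (U_near⁻¹·W_near) + dist1 ((U□)⁻¹·(W□)) + dist1 (covariant rail-pair difference)` (any torus, any `GaugeGroup`; EXACT, no smallness)

Cell `ym3-torus` (rung R3 = continuum `SU(2)` YM₃ on T³ at fixed lattice data — NOT d = 4, NOT infinite volume, NOT a mass gap, NOT Clay).  Width seat `ym3-torus-px5` (gen 23);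
crux `stmt-QuantumFields-20520`, LINE g18-1 S2β; GAP♯∘ ⟸ {h3, D-GUARD×2, (ST)} by kernel (✓p828867 ∘ ✓p829725); (ST) ⟸ (SCT) ∧ (LIFT) ∧ (LADDER) — the LIFT-RECURSION knit in
TWO-PROFILE form (px16 g22 17:25:00Z lane word; engine px21 g24 (W2); typist px17 g22).  Its (LADDER-M) hypothesis is `R(t+1) ≤ T₁₁·M t + T₁₂·V t + ℓ_lad·ρ(t+1)`: the chord of a
RUNG bond at the far end of a comb ladder ≤ (chord of the base rung = a comb bond, (LIFT-M)) + Σ (covariant DIFFERENCES of the two rails' comb chords, (LIFT-V)) + Σ (relative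
plaquettes).  Q11a ✓p829361 `dist1_ladder_rel_le` charges each bottom-rail chord at face value (`2·dist1`); THIS FILE is the sharper per-square step the two-profile recursion wants:
the rails enter only through their covariant PAIR DIFFERENCE, which vanishes when the two rail chords agree after transport.  `--kind proof --supports stmt-QuantumFields-20520
--as helper`, count-neutral, DEFINITION-FREE (0 `def`, 0 `instance`, 0 `notation`, 0 `sorry`, default heartbeats); generic `P : Params`, ANY `GaugeGroup G`.

NOTATION (one unit square at `z` spanned by the RAIL direction `κ` and the RUNG direction `e`): `bot := ⟨z, κ⟩`, `far := ⟨z+κ, e⟩`, `top := ⟨z+e, κ⟩`, `near := ⟨z, e⟩`;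
`□_X := X_bot·X_far·X_top⁻¹·X_near⁻¹` ((B4a)'s unit square, so `X_far = X_bot⁻¹·□_X·X_near·X_top` and `X_near = □_X⁻¹·X_bot·X_far·X_top⁻¹`); chords in the `U⁻¹·W` convention of
the letter's `REL` (`dist1 ((U∂p)⁻¹·W∂p)`); `dist1 (a·b⁻¹) = dist1 (b⁻¹·a)` (px10 ✓`dist1_mul_inv_eq_rel`) converts freely.

WHAT IS PROVED (sorry-free; three `dist1_conj` + two `dist1_mul_le` each).
* §1 ★★★`dist1_farRung_rel_le` — **`dist1 (U_far⁻¹·W_far) ≤ dist1 (□_U⁻¹·□_W) + dist1 (U_near⁻¹·W_near) + dist1 ((W_top·U_top⁻¹)·T⁻¹·(U_bot·W_bot⁻¹)·T)`**, `T := □_U·U_near`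
  (`= U_bot·U_far·U_top⁻¹`, the `U`-transport around the three other sides): the last term is the COVARIANT RAIL-PAIR DIFFERENCE — top-rail chord against the transported inverse
  bottom-rail chord.
* §2 ★★★`dist1_nearRung_rel_le` — the same square read backwards: **`dist1 (U_near⁻¹·W_near) ≤ dist1 (□_U⁻¹·□_W) + dist1 (U_far⁻¹·W_far) + dist1 ((W_top⁻¹·U_top)·U_far⁻¹·(U_bot⁻¹·W_bot)·U_far)`**
  (transport = the far rung) — for comb segments walked in the negative direction (centred blocks have both signs).
* §3 `dist1_square_transport_eq` (`□_U·U_near = U_bot·U_far·U_top⁻¹`, bookkeeping for the typist who prefers the three-side transport).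

HONEST SCOPE.  Group algebra on one lattice square; nothing of Bałaban's analysis is asserted or proved; the ITERATION along a comb tail (summing §1∕§2 over `≤ ℓ_lad` squares) and
the sups over read sets are the knit's bookkeeping, not here; (ST)∕(SCT)∕(LIFT), LOC's discharge, «MULT♭-ax»∕«CRIT-ax», (D-stage), h3, GAP♯∘ (`stub_uniformFibreGapOrbit`, registry
3732b7df UNTOUCHED, 0∕5), S2β, the five registered stubs, 20520, 19936, 19200, `YM3TorusSU2` NOT proved; no summit statement is proved by a helper; rung R3 — NOT d = 4, NOT infinite
volume, NOT a mass gap, NOT Clay; the Yang–Mills mass gap is NOT proved.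

References: T. Bałaban, CMP **122** (1989) 355–392 [Balaban1989LargeFieldII] (p.382, tree-gauge bonds as loops spanned by plaquettes); CMP **98** (1985) 17–51
[Balaban1985Averaging] ((9)–(10) p.19, (19) p.21).
-/

set_option autoImplicit false

namespace Summit.QuantumFields.YangMills.Theorems.FluctuationComparisonRegPrIntLS2BetaRelativeLadderStep

open Literature.MathematicalPhysics.QuantumFieldTheory.Balaban1983to89
open Literature.MathematicalPhysics.QuantumFieldTheory.Balaban1983to89.T4Continuum

variable {P : Params} {j : ℕ} {G : Type*} [GaugeGroup G]

/-! ## §1 The forward step: far rung from near rung -/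

/-- ★★★ **THE RUNG-TO-RUNG STEP, FORWARD**: for two configurations `W, U` and the unit square at `z` spanned by the rail direction `κ` and the rung direction `e`,
`dist1 (U_far⁻¹·W_far) ≤ dist1 (□_U⁻¹·□_W) + dist1 (U_near⁻¹·W_near) + dist1 ((W_top·U_top⁻¹)·T⁻¹·(U_bot·W_bot⁻¹)·T)` with `T = □_U·U_near` — relative plaquette + previous rung chord + the
COVARIANT RAIL-PAIR DIFFERENCE; exact, no smallness. [cite: Balaban1989LargeFieldII, p.382; Balaban1985Averaging, (9)-(10) p.19 (bookkeeping)] -/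
theorem dist1_farRung_rel_le (W U : GaugeField P j G) (z : Site P j) (κ e : Fin P.d) :
    dist1 ((U ⟨z.shift κ, e⟩)⁻¹ * W ⟨z.shift κ, e⟩) ≤
      dist1 ((U ⟨z, κ⟩ * U ⟨z.shift κ, e⟩ * (U ⟨z.shift e, κ⟩)⁻¹ * (U ⟨z, e⟩)⁻¹)⁻¹ *
          (W ⟨z, κ⟩ * W ⟨z.shift κ, e⟩ * (W ⟨z.shift e, κ⟩)⁻¹ * (W ⟨z, e⟩)⁻¹)) +
        dist1 ((U ⟨z, e⟩)⁻¹ * W ⟨z, e⟩) +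
        dist1 ((W ⟨z.shift e, κ⟩ * (U ⟨z.shift e, κ⟩)⁻¹) *
          ((U ⟨z, κ⟩ * U ⟨z.shift κ, e⟩ * (U ⟨z.shift e, κ⟩)⁻¹ * (U ⟨z, e⟩)⁻¹ * U ⟨z, e⟩)⁻¹ * (U ⟨z, κ⟩ * (W ⟨z, κ⟩)⁻¹) *
            (U ⟨z, κ⟩ * U ⟨z.shift κ, e⟩ * (U ⟨z.shift e, κ⟩)⁻¹ * (U ⟨z, e⟩)⁻¹ * U ⟨z, e⟩))) := by
  -- names
  set Ub := U ⟨z, κ⟩; set Uf := U ⟨z.shift κ, e⟩; set Ut := U ⟨z.shift e, κ⟩; set Un := U ⟨z, e⟩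
  set Wb := W ⟨z, κ⟩; set Wf := W ⟨z.shift κ, e⟩; set Wt := W ⟨z.shift e, κ⟩; set Wn := W ⟨z, e⟩
  set sqU := Ub * Uf * Ut⁻¹ * Un⁻¹
  set sqW := Wb * Wf * Wt⁻¹ * Wn⁻¹
  set q := sqU⁻¹ * sqW
  set r := Un⁻¹ * Wn
  set a := Ub * Wb⁻¹
  set b := Wt * Ut⁻¹
  set T := sqU * Un
  -- the exact identity: `U_far⁻¹·W_far = U_top⁻¹·((T⁻¹·a·T)·(U_near⁻¹·q·U_near)·r·b)·U_top`
  have key : Uf⁻¹ * Wf = Ut⁻¹ * ((T⁻¹ * a * T) * (Un⁻¹ * q * Un) * r * b) * Ut⁻¹⁻¹ := by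
    simp only [q, r, a, b, T, sqU, sqW]; group
  rw [key, GaugeGroup.dist1_conj]
  -- `dist1 (A·Q·r·b) = dist1 (Q·r·b·A) ≤ dist1 Q + dist1 (r·b·A) ≤ dist1 Q + dist1 r + dist1 (b·A)`
  set A := T⁻¹ * a * T
  set Q := Un⁻¹ * q * Un
  have hrot : dist1 (A * Q * r * b) = dist1 (Q * (r * (b * A))) := by
    have h : Q * (r * (b * A)) = A⁻¹ * (A * Q * r * b) * A⁻¹⁻¹ := by group
    rw [h, GaugeGroup.dist1_conj]
  rw [hrot]
  have hQ : dist1 Q = dist1 q := by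
    have h : Q = Un⁻¹ * q * Un⁻¹⁻¹ := by simp only [Q, inv_inv]
    rw [h, GaugeGroup.dist1_conj]
  have h1 := GaugeGroup.dist1_mul_le Q (r * (b * A))
  have h2 := GaugeGroup.dist1_mul_le r (b * A)
  have hbA : dist1 (b * A) = dist1 (b * T⁻¹ * a * T) := by simp only [A, mul_assoc]
  rw [hQ] at h1
  have hgoal : dist1 (b * T⁻¹ * a * T) = dist1 (Wt * Ut⁻¹ * (sqU * Un)⁻¹ * (Ub * Wb⁻¹) * (sqU * Un)) := by simp only [b, T, a]
  linarith [h1, h2, hbA.symm.le, hbA.le, hgoal.le, hgoal.symm.le]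

/-! ## §2 The backward step: near rung from far rung -/

/-- ★★★ **THE RUNG-TO-RUNG STEP, BACKWARD** (the same square solved for the near rung):
`dist1 (U_near⁻¹·W_near) ≤ dist1 (□_U⁻¹·□_W) + dist1 (U_far⁻¹·W_far) + dist1 ((W_top⁻¹·U_top)·U_far⁻¹·(U_bot⁻¹·W_bot)·U_far)` — for comb segments walked backwards.
[cite: Balaban1989LargeFieldII, p.382; Balaban1985Averaging, (9)-(10) p.19 (bookkeeping)] -/
theorem dist1_nearRung_rel_le (W U : GaugeField P j G) (z : Site P j) (κ e : Fin P.d) :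
    dist1 ((U ⟨z, e⟩)⁻¹ * W ⟨z, e⟩) ≤
      dist1 ((U ⟨z, κ⟩ * U ⟨z.shift κ, e⟩ * (U ⟨z.shift e, κ⟩)⁻¹ * (U ⟨z, e⟩)⁻¹)⁻¹ *
          (W ⟨z, κ⟩ * W ⟨z.shift κ, e⟩ * (W ⟨z.shift e, κ⟩)⁻¹ * (W ⟨z, e⟩)⁻¹)) +
        dist1 ((U ⟨z.shift κ, e⟩)⁻¹ * W ⟨z.shift κ, e⟩) +
        dist1 (((W ⟨z.shift e, κ⟩)⁻¹ * U ⟨z.shift e, κ⟩) * ((U ⟨z.shift κ, e⟩)⁻¹ * ((U ⟨z, κ⟩)⁻¹ * W ⟨z, κ⟩) * U ⟨z.shift κ, e⟩)) := by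
  set Ub := U ⟨z, κ⟩; set Uf := U ⟨z.shift κ, e⟩; set Ut := U ⟨z.shift e, κ⟩; set Un := U ⟨z, e⟩
  set Wb := W ⟨z, κ⟩; set Wf := W ⟨z.shift κ, e⟩; set Wt := W ⟨z.shift e, κ⟩; set Wn := W ⟨z, e⟩
  set sqU := Ub * Uf * Ut⁻¹ * Un⁻¹
  set sqW := Wb * Wf * Wt⁻¹ * Wn⁻¹
  set p := sqU * sqW⁻¹
  set r₂ := Uf⁻¹ * Wf
  set a₂ := Ub⁻¹ * Wb
  set b₂ := Wt⁻¹ * Ut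
  -- `U_near⁻¹·W_near = U_top·(P·A₂·r₂·b₂)·U_top⁻¹` with `P = U_far⁻¹·U_bot⁻¹·p·U_bot·U_far`, `A₂ = U_far⁻¹·a₂·U_far`
  have key : Un⁻¹ * Wn = Ut * ((Uf⁻¹ * (Ub⁻¹ * p * Ub) * Uf) * (Uf⁻¹ * a₂ * Uf) * r₂ * b₂) * Ut⁻¹ := by
    simp only [p, r₂, a₂, b₂, sqU, sqW]; group
  rw [key, GaugeGroup.dist1_conj]
  set PP := Uf⁻¹ * (Ub⁻¹ * p * Ub) * Uf
  set A₂ := Uf⁻¹ * a₂ * Uf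
  have hrot : dist1 (PP * A₂ * r₂ * b₂) = dist1 (PP * (A₂ * (r₂ * b₂))) := by simp only [mul_assoc]
  rw [hrot]
  have hP : dist1 PP = dist1 (sqU⁻¹ * sqW) := by
    have h : PP = (Ub * Uf)⁻¹ * p * (Ub * Uf)⁻¹⁻¹ := by simp only [PP]; group
    rw [h, GaugeGroup.dist1_conj, ← GaugeGroup.dist1_inv p]
    have hx : p⁻¹ = sqU * (sqU⁻¹ * sqW) * sqU⁻¹ := by simp only [p]; group
    rw [hx, GaugeGroup.dist1_conj]
  have h1 := GaugeGroup.dist1_mul_le PP (A₂ * (r₂ * b₂))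
  have hrot2 : dist1 (A₂ * (r₂ * b₂)) = dist1 (r₂ * (b₂ * A₂)) := by
    have h : r₂ * (b₂ * A₂) = A₂⁻¹ * (A₂ * (r₂ * b₂)) * A₂⁻¹⁻¹ := by group
    rw [h, GaugeGroup.dist1_conj]
  have h2 := GaugeGroup.dist1_mul_le r₂ (b₂ * A₂)
  have hbA : dist1 (b₂ * A₂) = dist1 (Wt⁻¹ * Ut * (Uf⁻¹ * (Ub⁻¹ * Wb) * Uf)) := by simp only [b₂, A₂, a₂]
  rw [hP] at h1
  rw [hrot2] at h1
  linarith [h1, h2, hbA.le, hbA.symm.le]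

/-! ## §3 The three-side transport -/

/-- `□_U·U_near = U_bot·U_far·U_top⁻¹` (the forward step's transport is the `U`-holonomy around the other three sides). [folklore] -/
theorem dist1_square_transport_eq (U : GaugeField P j G) (z : Site P j) (κ e : Fin P.d) :
    U ⟨z, κ⟩ * U ⟨z.shift κ, e⟩ * (U ⟨z.shift e, κ⟩)⁻¹ * (U ⟨z, e⟩)⁻¹ * U ⟨z, e⟩ = U ⟨z, κ⟩ * U ⟨z.shift κ, e⟩ * (U ⟨z.shift e, κ⟩)⁻¹ := by
  group

end Summit.QuantumFields.YangMills.Theorems.FluctuationComparisonRegPrIntLS2BetaRelativeLadderStep
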